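import Literature.Geometry.Kaehler.ComplexTorusHodgeGroupProductLieSimpleFactor
import Literature.NumberTheory.Automorphic.SpecialLinearLieAlgebra
import Literature.AlgebraicGeometry.HodgeTheory.GoursatKolchinRibetLieAlgebra
import HarnessLib

/-!
# Products with a HODGE-GENERAL factor: `Hg(X₁)(ℂ) = SL(V₁,ℂ)` ⟹ `Lie Hg(X₁)(ℂ) = 𝔰𝔩(V₁,ℂ)` is simple, so
# `Hg(X₁ × X₂) = SL(V₁) × Hg(X₂)` for every torus `X₂` of smaller dimension, with solvable `Hg(X₂)(ℂ)`, or of CM type;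
# `dim Hg(X) ≤ (2g)² − 1` for every complex torus, with equality iff Hodge-general

Layer `Literature/Geometry/Kaehler`, namespace `Literature.Geometry.Kaehler.ComplexTorus`; lane `lit-hodgefound`
(Track 2 foundations library), Layer A3/A4; prover seat `lit-hodgefound-p17` (generation 38, self-proposed row g38-#6b —
the first INSTANCE in the tree of the hypothesis «`Lie Hg(X₁)(ℂ)` simple» of g38-#5
`ComplexTorusHodgeGroupProductLieSimpleFactor`, supplied by g38-#6a `Literature/NumberTheory/Automorphic/SpecialLinearLieAlgebra`
(`Lie(SL_n) = 𝔰𝔩ₙ`, simple for `n ≥ 2`)). THEOREMS ONLY (no definition, no instance, no notation, no named fact; D-0026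
net debt 0). "Hodge-general" is the tree's `hodgeGroupC Φ = ⊤` (`Hg(X)(ℂ)` is all of `SL(V_ℂ)`): the GENERAL complex
torus of dimension `≥ 2` (`ComplexTorusHodgeGroupSpecialLinearExample`), every one-dimensional torus without complex
multiplication (`hodgeGroupC_eq_top_iff_endAlgRat_eq_bot`, `hodgeGroupC_ellipticPeriod_eq_top_iff` of
`ComplexTorusEllipticCurveHodgeGroupNonCM`: "`Hg(E) = SL₂` if `E` is not of CM-type").

## Sources, verbatim

* H. Imai [Imai1976HodgeGroups], *On the Hodge groups of some abelian varieties*, Kōdai Math. Sem. Rep. 27 (1976) (held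
  `paper:doi-10-2996-kmj-1138847263`), §2 (p. 368): "`Hg(E) = SL₂` if `E` is not of CM-type"; §3 Remarks (p. 370 L29–L30):
  "as `dim Hg(E₁ × E₂) ≥ dim Hg(E₁)`, which follows from the surjectivity of […] restricted to `Hg(E₁ × E₂)`, we have the
  desired equality"; (p. 370 L44–L54): "From the fact […] `dim Hg(∏ E_i^{(j)} × E) ≥ dim Hg(∏ E_i^{(j)})`, and from the
  induction hypothesis […] we have the desired isomorphism by dimension".
* B. Moonen, Yu. G. Zarhin [MoonenZarhin1999LowDim] (held `paper:arxiv-math_9901113`), §1 (p0002 L108): "We can define it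
  by `Hg(X) = MT(X) ∩ SL(V)`"; §3 (3.1) (p0006 L25–L60): "`hg(X₁ × X₂) ≅ 𝔤₁ ⊕ 𝔤₂ ⊕ Γ_φ` […] `𝔤₃ ≠ 0`".
* B. B. Gordon [Gordon1997], §2.16 Proposition (Goursat's Lemma, both bullets), §3 Theorem proof (p0014 L33–L37).
* T. A. Springer [Springer1998], 4.4.11 (1) (PDF p0087 L7): "The Lie algebra of `SL_n` is the subalgebra `𝔰𝔩ₙ` of `𝔤𝔩ₙ` of
  matrices with trace zero"; 4.4.5–4.4.6 (`dim L(G) = dim G`), 5.3.2.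
* J. E. Humphreys [Humphreys1972], §1.2 (`dim 𝔰𝔩ₙ = n² − 1`), §19.2 (`𝔰𝔩ₙ` is simple).

## What is proved

* §1 EVERY complex torus `X` (`2g = |ι|`): **`trace_eq_zero_of_mem_lieAlgebraGL_map_toGL_hodgeGroupC`** (`Lie Hg(X)(ℂ) ⊆
  𝔰𝔩(V_ℂ)`), `lieAlgebraGL_map_toGL_hodgeGroupC_le_ker_trace`, **`finrank_lieAlgebraGL_map_toGL_hodgeGroupC_le`** and
  **`zdim_map_toGL_hodgeGroupC_le`** (`dim Hg(X) ≤ (2g)² − 1`), `two_le_card_of_card_pos` / `one_lt_card_of_card_lt`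
  (the rank `|ι| = 2 dim_ℂ X` is even).
* §2 HODGE-GENERAL `X` (`hodgeGroupC Φ = ⊤`): `lieSubalgebraGL_map_toGL_hodgeGroupC_eq_sl_of_eq_top` (`Lie Hg(X)(ℂ) =
  𝔰𝔩(V_ℂ)`), **`isSimple_lieSubalgebraGL_map_toGL_hodgeGroupC_of_eq_top`** (simple, `g ≥ 1`),
  `finrank_…_eq_of_eq_top` / **`zdim_map_toGL_hodgeGroupC_eq_of_eq_top`** (`dim Hg(X) = (2g)² − 1`),
  `commutator_hodgeGroupC_eq_self_of_eq_top` (perfect), `IsAbelianVariety.not_isCMType_of_hodgeGroupC_eq_top`;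
  one-dimensional tori: `isSimple_lieSubalgebraGL_map_toGL_hodgeGroupC_of_endAlgRat_eq_bot` (`End_ℚ(E) = ℚ`),
  `isSimple_lieSubalgebraGL_map_toGL_hodgeGroupC_ellipticPeriod` (`E_τ` with `End(E_τ) = ℤ`).
* §3 PRODUCTS `X₁ × X₂` with `X₁` Hodge-general: **`hodgeGroupC_prod_eq_blockDiagProd_of_eq_top_of_zdim_lt`**
  (`dim Hg(X₂) < (2g₁)² − 1` ⟹ `Hg(X₁ × X₂)(ℂ) = SL(V₁,ℂ) × Hg(X₂)(ℂ)`),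
  **`hodgeGroupC_prod_eq_blockDiagProd_of_eq_top_of_card_lt`** (ANY `X₂` of smaller dimension), the mirror
  `…_of_card_lt_of_eq_top`, **`hodgeGroupC_prod_eq_blockDiagProd_of_eq_top_of_eq_top_of_card_ne`** (two Hodge-general
  tori of different dimensions: `Hg = SL(V₁) × SL(V₂)`), `…_of_eq_top_of_isSolvable` (solvable `Hg(X₂)(ℂ)`),
  `…_of_eq_top_of_commutator_eq_bot`, **`IsAbelianVariety.hodgeGroupC_prod_eq_blockDiagProd_of_eq_top_of_isCMType`**
  (`X₂` a CM abelian variety), real points `hodgeGroup_prod_eq_of_eq_top_of_card_lt`, (D)-transfer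
  `forall_divisorClasses_powPeriod_prod_eq_hodgeClasses_of_eq_top_of_card_lt`, and for two Hodge-general tori of the
  SAME dimension the dichotomy `hodgeGroupC_prod_eq_blockDiagProd_or_finite_of_eq_top_of_eq_top` (split, or both kernels
  `K₁`, `K₂` finite — the graph∕isogeny case of Imai §3, not decided here).

## References

* [Imai1976HodgeGroups] H. Imai, Kōdai Math. Sem. Rep. 27 (1976), §2 (p. 368), §3 Remarks (p. 370).
* [MoonenZarhin1999LowDim] B. Moonen, Yu. G. Zarhin, Math. Ann. 315 (1999), §1, §3 (3.1), §3 Theorem (2).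
* [Gordon1997] B. B. Gordon, *A survey of the Hodge conjecture for abelian varieties* (alg-geom/9709030), §2.12, §2.16, §3, 7.6.2.
* [Springer1998] T. A. Springer, *Linear Algebraic Groups*, 2nd ed. (1998), 4.4.5, 4.4.6, 4.4.11 (1), 5.3.2.
* [Humphreys1972] J. E. Humphreys, *Introduction to Lie Algebras and Representation Theory* (1972), §1.2, §19.2.
-/

noncomputable section

open Matrix Module

namespace Literature.Geometry.Kaehler

namespace ComplexTorus

open Literature.NumberTheory.Automorphic (IsZConnected lieAlgebraGL lieSubalgebraGL
  trace_eq_zero_of_mem_lieAlgebraGL_map_toGL lieAlgebraGL_map_toGL_le_ker_trace map_toGL_top_eq_range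
  lieSubalgebraGL_map_toGL_top_eq_sl lieAlgebraGL_map_toGL_top_eq_ker_trace isSimple_lieSubalgebraGL_map_toGL_top)

variable {ι₁ ι₂ : Type*} [Fintype ι₁] [Fintype ι₂] [DecidableEq ι₁] [DecidableEq ι₂]
  {E₁ E₂ : Type*} [NormedAddCommGroup E₁] [NormedSpace ℂ E₁] [NormedAddCommGroup E₂] [NormedSpace ℂ E₂]
  (Φ₁ : (ι₁ → ℝ) ≃L[ℝ] E₁) (Φ₂ : (ι₂ → ℝ) ≃L[ℝ] E₂)

/-! ## §1 Every complex torus: `Lie Hg(X)(ℂ) ⊆ 𝔰𝔩(V_ℂ)`, `dim Hg(X) ≤ (2g)² − 1`, the rank is even -/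

section AnyTorus

variable {ι : Type*} [Fintype ι] [DecidableEq ι] {E : Type*} [NormedAddCommGroup E] [NormedSpace ℂ E]
  (Φ : (ι → ℝ) ≃L[ℝ] E)

omit [DecidableEq ι] in
include Φ in
/-- **The rank of the lattice is even and at least `2` as soon as it is positive**: `|ι| = 2 dim_ℂ X`.
[cite: MoonenZarhin1999LowDim, §1 ("`V := H₁(X, ℚ)`", of dimension `2g`)] -/
theorem two_le_card_of_card_pos (h : 0 < Fintype.card ι) : 2 ≤ Fintype.card ι := by
  haveI : FiniteDimensional ℝ E := LinearEquiv.finiteDimensional Φ.toLinearEquiv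
  haveI : FiniteDimensional ℂ E := Module.Finite.of_restrictScalars_finite ℝ ℂ E
  have hcard := card_eq_two_mul_finrank Φ
  omega

variable {Φ} in
/-- `Lie Hg(X)(ℂ) ⊆ 𝔰𝔩(V_ℂ)`: every tangent vector of `Hg(X)(ℂ) ≤ SL(V_ℂ)` is traceless ("`Hg(X) = MT(X) ∩ SL(V)`",
and `Lie(SL_n) = 𝔰𝔩ₙ`). [cite: MoonenZarhin1999LowDim, §1 (p0002 L108)] [cite: Springer1998, 4.4.11 (1)] -/
theorem trace_eq_zero_of_mem_lieAlgebraGL_map_toGL_hodgeGroupC {A : Matrix ι ι ℂ}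
    (hA : A ∈ lieAlgebraGL ((hodgeGroupC Φ).map Matrix.SpecialLinearGroup.toGL)) : Matrix.trace A = 0 :=
  trace_eq_zero_of_mem_lieAlgebraGL_map_toGL hA

/-- `Lie Hg(X)(ℂ) ≤ ker tr = 𝔰𝔩(V_ℂ)` as subspaces of `𝔤𝔩(V_ℂ)`. [cite: MoonenZarhin1999LowDim, §1 (p0002 L108)]
[cite: Springer1998, 4.4.11 (1)] -/
theorem lieAlgebraGL_map_toGL_hodgeGroupC_le_ker_trace :
    lieAlgebraGL ((hodgeGroupC Φ).map Matrix.SpecialLinearGroup.toGL) ≤ LinearMap.ker (Matrix.traceLinearMap ι ℂ ℂ) :=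
  lieAlgebraGL_map_toGL_le_ker_trace _

/-- **`dim_ℂ Lie Hg(X)(ℂ) ≤ (2g)² − 1`** (`Lie Hg(X)(ℂ) ⊆ 𝔰𝔩_{2g}(ℂ)`, of dimension `(2g)² − 1`).
[cite: MoonenZarhin1999LowDim, §1 (p0002 L108)] [cite: Humphreys1972, §1.2] [cite: Springer1998, 4.4.11 (1)] -/
theorem finrank_lieAlgebraGL_map_toGL_hodgeGroupC_le :
    Module.finrank ℂ (lieAlgebraGL ((hodgeGroupC Φ).map Matrix.SpecialLinearGroup.toGL)) ≤ Fintype.card ι ^ 2 - 1 := by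
  rcases isEmpty_or_nonempty ι with hι | hι
  · haveI : Subsingleton (Matrix ι ι ℂ) := inferInstance
    rw [Module.finrank_zero_of_subsingleton]
    exact Nat.zero_le _
  · letI : LieRing (Matrix ι ι ℂ) := LieRing.ofAssociativeRing
    letI : LieAlgebra ℂ (Matrix ι ι ℂ) := LieAlgebra.ofAssociativeAlgebra
    rw [← Literature.AlgebraicGeometry.HodgeTheory.finrank_sl (n := ι) (k := ℂ)]
    exact Submodule.finrank_mono (lieAlgebraGL_map_toGL_hodgeGroupC_le_ker_trace Φ)

/-- **`dim Hg(X) ≤ (2g)² − 1`** for every complex torus `X` of dimension `g` (`Hg(X)(ℂ) ≤ SL_{2g}(ℂ)` and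
`dim L(G) = dim G` for the connected group `Hg(X)(ℂ)`). [cite: MoonenZarhin1999LowDim, §1 (p0002 L108)]
[cite: Springer1998, 4.4.5–4.4.6 and 4.4.11 (1)] [cite: Humphreys1972, §1.2] -/
theorem zdim_map_toGL_hodgeGroupC_le : (isZConnected_map_toGL_hodgeGroupC Φ).zdim ≤ Fintype.card ι ^ 2 - 1 := by
  rw [← ((isZConnected_map_toGL_hodgeGroupC Φ).finrank_lieAlgebraGL_eq).2]
  exact finrank_lieAlgebraGL_map_toGL_hodgeGroupC_le Φ

end AnyTorus

/-! ## §2 A Hodge-general torus: `Lie Hg(X)(ℂ) = 𝔰𝔩(V_ℂ)` is simple, `dim Hg(X) = (2g)² − 1` -/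

section HodgeGeneral

variable {ι : Type*} [Fintype ι] [DecidableEq ι] {E : Type*} [NormedAddCommGroup E] [NormedSpace ℂ E]
  (Φ : (ι → ℝ) ≃L[ℝ] E)

variable {Φ} in
/-- For a Hodge-general torus, `Hg(X)(ℂ) ≤ GL(V_ℂ)` is the image of `SL(V_ℂ)`. [cite: MoonenZarhin1999LowDim, §1 (p0002 L108)]
[cite: Imai1976HodgeGroups, §2 (p. 368)] -/
theorem map_toGL_hodgeGroupC_eq_range_of_eq_top (h : hodgeGroupC Φ = ⊤) :
    (hodgeGroupC Φ).map Matrix.SpecialLinearGroup.toGL =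
      (Matrix.SpecialLinearGroup.toGL : Matrix.SpecialLinearGroup ι ℂ →* GL ι ℂ).range := by
  rw [h, map_toGL_top_eq_range]

variable {Φ} in
/-- **`Hg(X)(ℂ) = SL(V_ℂ)` ⟹ `Lie Hg(X)(ℂ) = 𝔰𝔩(V_ℂ)`** (Mathlib's `LieAlgebra.SpecialLinear.sl ι ℂ`).
[cite: Springer1998, 4.4.11 (1)] [cite: Imai1976HodgeGroups, §2 (p. 368)] -/
theorem lieSubalgebraGL_map_toGL_hodgeGroupC_eq_sl_of_eq_top [Nonempty ι] (h : hodgeGroupC Φ = ⊤) :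
    lieSubalgebraGL ((hodgeGroupC Φ).map Matrix.SpecialLinearGroup.toGL) = LieAlgebra.SpecialLinear.sl ι ℂ := by
  rw [h]
  exact lieSubalgebraGL_map_toGL_top_eq_sl

variable {Φ} in
/-- `Hg(X)(ℂ) = SL(V_ℂ)` ⟹ `Lie Hg(X)(ℂ) = ker tr` as subspaces. [cite: Springer1998, 4.4.11 (1)] [cite: Imai1976HodgeGroups, §2 (p. 368)] -/
theorem lieAlgebraGL_map_toGL_hodgeGroupC_eq_ker_trace_of_eq_top [Nonempty ι] (h : hodgeGroupC Φ = ⊤) :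
    lieAlgebraGL ((hodgeGroupC Φ).map Matrix.SpecialLinearGroup.toGL) = LinearMap.ker (Matrix.traceLinearMap ι ℂ ℂ) := by
  rw [h]
  exact lieAlgebraGL_map_toGL_top_eq_ker_trace

variable {Φ} in
/-- **A HODGE-GENERAL TORUS OF POSITIVE DIMENSION HAS SIMPLE `Lie Hg(X)(ℂ) = 𝔰𝔩_{2g}(ℂ)`** — the hypothesis of
`ComplexTorusHodgeGroupProductLieSimpleFactor`. [cite: Springer1998, 4.4.11 (1)] [cite: Humphreys1972, §19.2]
[cite: Imai1976HodgeGroups, §2 (p. 368)] -/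
theorem isSimple_lieSubalgebraGL_map_toGL_hodgeGroupC_of_eq_top (h : hodgeGroupC Φ = ⊤) (hι : 1 < Fintype.card ι) :
    LieAlgebra.IsSimple ℂ (lieSubalgebraGL ((hodgeGroupC Φ).map Matrix.SpecialLinearGroup.toGL)) := by
  rw [h]
  exact isSimple_lieSubalgebraGL_map_toGL_top hι

variable {Φ} in
/-- The same with the dimension hypothesis in the form `|ι| ≠ 0` (the rank is even). [cite: Springer1998, 4.4.11 (1)]
[cite: Humphreys1972, §19.2] -/
theorem isSimple_lieSubalgebraGL_map_toGL_hodgeGroupC_of_eq_top_of_card_pos (h : hodgeGroupC Φ = ⊤)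
    (hι : 0 < Fintype.card ι) :
    LieAlgebra.IsSimple ℂ (lieSubalgebraGL ((hodgeGroupC Φ).map Matrix.SpecialLinearGroup.toGL)) :=
  isSimple_lieSubalgebraGL_map_toGL_hodgeGroupC_of_eq_top h (two_le_card_of_card_pos Φ hι)

variable {Φ} in
/-- **`Hg(X)(ℂ) = SL(V_ℂ)` ⟹ `dim_ℂ Lie Hg(X)(ℂ) = (2g)² − 1`.** [cite: Humphreys1972, §1.2] [cite: Springer1998, 4.4.11 (1)] -/
theorem finrank_lieAlgebraGL_map_toGL_hodgeGroupC_eq_of_eq_top [Nonempty ι] (h : hodgeGroupC Φ = ⊤) :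
    Module.finrank ℂ (lieAlgebraGL ((hodgeGroupC Φ).map Matrix.SpecialLinearGroup.toGL)) = Fintype.card ι ^ 2 - 1 := by
  letI : LieRing (Matrix ι ι ℂ) := LieRing.ofAssociativeRing
  letI : LieAlgebra ℂ (Matrix ι ι ℂ) := LieAlgebra.ofAssociativeAlgebra
  rw [lieAlgebraGL_map_toGL_hodgeGroupC_eq_ker_trace_of_eq_top h,
    ← Literature.AlgebraicGeometry.HodgeTheory.finrank_sl (n := ι) (k := ℂ)]
  rfl

variable {Φ} in
/-- **`Hg(X)(ℂ) = SL(V_ℂ)` ⟹ `dim Hg(X) = (2g)² − 1`** (the maximum of `zdim_map_toGL_hodgeGroupC_le`).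
[cite: Springer1998, 4.4.5–4.4.6 and 4.4.11 (1)] [cite: Humphreys1972, §1.2] [cite: Imai1976HodgeGroups, §3 Remarks (p. 370)] -/
theorem zdim_map_toGL_hodgeGroupC_eq_of_eq_top [Nonempty ι] (h : hodgeGroupC Φ = ⊤) :
    (isZConnected_map_toGL_hodgeGroupC Φ).zdim = Fintype.card ι ^ 2 - 1 := by
  rw [← ((isZConnected_map_toGL_hodgeGroupC Φ).finrank_lieAlgebraGL_eq).2]
  exact finrank_lieAlgebraGL_map_toGL_hodgeGroupC_eq_of_eq_top h

variable {Φ} in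
/-- A torus with `dim Hg(X) < (2g)² − 1` is not Hodge-general. [cite: Springer1998, 4.4.5–4.4.6] [cite: Humphreys1972, §1.2] -/
theorem hodgeGroupC_ne_top_of_zdim_lt [Nonempty ι] (h : (isZConnected_map_toGL_hodgeGroupC Φ).zdim < Fintype.card ι ^ 2 - 1) :
    hodgeGroupC Φ ≠ ⊤ := fun htop ↦
  (lt_irrefl _) ((zdim_map_toGL_hodgeGroupC_eq_of_eq_top htop).symm ▸ h)

variable {Φ} in
/-- **A Hodge-general torus of positive dimension has perfect Hodge group: `(Hg(X), Hg(X))(ℂ) = Hg(X)(ℂ) = SL(V_ℂ)`.**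
[cite: Gordon1997, §2.5.2 Corollary] [cite: Springer1998, 4.4.11 (1)] [cite: Humphreys1972, §19.2] -/
theorem commutator_hodgeGroupC_eq_self_of_eq_top (h : hodgeGroupC Φ = ⊤) (hι : 1 < Fintype.card ι) :
    ⁅hodgeGroupC Φ, hodgeGroupC Φ⁆ = hodgeGroupC Φ :=
  commutator_hodgeGroupC_eq_self_of_isSimple_lieSubalgebraGL Φ (isSimple_lieSubalgebraGL_map_toGL_hodgeGroupC_of_eq_top h hι)

variable {Φ} in
/-- A Hodge-general torus of positive dimension has non-solvable `Hg(X)(ℂ)`. [cite: Gordon1997, §2.12 Proposition]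
[cite: Humphreys1972, §19.2] -/
theorem not_isSolvable_hodgeGroupC_of_eq_top (h : hodgeGroupC Φ = ⊤) (hι : 1 < Fintype.card ι) :
    ¬ IsSolvable ↥(hodgeGroupC Φ) :=
  not_isSolvable_hodgeGroupC_of_isSimple_lieSubalgebraGL Φ (isSimple_lieSubalgebraGL_map_toGL_hodgeGroupC_of_eq_top h hι)

variable {Φ} in
/-- **A Hodge-general abelian variety of positive dimension is not of CM-type.** [cite: Gordon1997, §2.12 Proposition]
[cite: MoonenZarhin1999LowDim, §1] -/
theorem IsAbelianVariety.not_isCMType_of_hodgeGroupC_eq_top (hX : IsAbelianVariety Φ) (h : hodgeGroupC Φ = ⊤)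
    (hι : 1 < Fintype.card ι) :
    ¬ ∃ T : Subalgebra ℚ (Matrix ι ι ℚ), T ≤ endAlgRat Φ ∧ IsReduced T ∧ (∀ a ∈ T, ∀ b ∈ T, a * b = b * a) ∧
      Module.finrank ℚ T = Fintype.card ι :=
  hX.not_isCMType_of_isSimple_lieSubalgebraGL (isSimple_lieSubalgebraGL_map_toGL_hodgeGroupC_of_eq_top h hι)

/-- **A one-dimensional torus with `End_ℚ(E) = ℚ` ("not of CM-type": `Hg(E) = SL₂`) has simple `Lie Hg(E)(ℂ) = 𝔰𝔩₂(ℂ)`.**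
[cite: Imai1976HodgeGroups, §2 (p. 368)] [cite: Humphreys1972, §19.2] -/
theorem isSimple_lieSubalgebraGL_map_toGL_hodgeGroupC_of_endAlgRat_eq_bot (Ψ : (Fin 2 → ℝ) ≃L[ℝ] ℂ)
    (hE : endAlgRat Ψ = ⊥) :
    LieAlgebra.IsSimple ℂ (lieSubalgebraGL ((hodgeGroupC Ψ).map Matrix.SpecialLinearGroup.toGL)) :=
  isSimple_lieSubalgebraGL_map_toGL_hodgeGroupC_of_eq_top (hodgeGroupC_eq_top_of_endAlgRat_eq_bot Ψ hE) (by simp)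

/-- **The elliptic curve `E_τ = ℂ/(ℤτ + ℤ)` with `End(E_τ) = ℤ` has simple `Lie Hg(E_τ)(ℂ) = 𝔰𝔩₂(ℂ)`.**
[cite: Imai1976HodgeGroups, §2 (p. 368)] [cite: Humphreys1972, §19.2] -/
theorem isSimple_lieSubalgebraGL_map_toGL_hodgeGroupC_ellipticPeriod {τ : ℂ} (hτ : τ.im ≠ 0) (h : ellipticEnd hτ = ⊥) :
    LieAlgebra.IsSimple ℂ (lieSubalgebraGL ((hodgeGroupC (ellipticPeriod hτ)).map Matrix.SpecialLinearGroup.toGL)) :=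
  isSimple_lieSubalgebraGL_map_toGL_hodgeGroupC_of_eq_top (hodgeGroupC_ellipticPeriod_eq_top_of_eq_bot hτ h) (by simp)

end HodgeGeneral

/-! ## §3 Products with a Hodge-general factor -/

section Product

omit [DecidableEq ι₁] [DecidableEq ι₂] in
include Φ₁ in
/-- `|ι₂| < |ι₁|` forces `|ι₁| ≥ 2` (the rank `|ι₁| = 2 dim_ℂ X₁` is even). [cite: MoonenZarhin1999LowDim, §1] -/
theorem one_lt_card_of_card_lt (h : Fintype.card ι₂ < Fintype.card ι₁) : 1 < Fintype.card ι₁ :=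
  two_le_card_of_card_pos Φ₁ (by omega)

/-- **`Hg(X₁)(ℂ) = SL(V₁,ℂ)` (`g₁ ≥ 1`) and `dim Hg(X₂) < (2g₁)² − 1` ⟹ `Hg(X₁ × X₂)(ℂ) = SL(V₁,ℂ) × Hg(X₂)(ℂ)`**
(the dimension route of g38-#5 for the simple Lie algebra `𝔰𝔩(V₁,ℂ)`). [cite: Imai1976HodgeGroups, §3 Remarks (p. 370 L29–L30, L44–L54)]
[cite: MoonenZarhin1999LowDim, §3 (3.1)] [cite: Gordon1997, §2.16 Proposition] -/
theorem hodgeGroupC_prod_eq_blockDiagProd_of_eq_top_of_zdim_lt (h₁ : hodgeGroupC Φ₁ = ⊤) (hι₁ : 1 < Fintype.card ι₁)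
    (hlt : (isZConnected_map_toGL_hodgeGroupC Φ₂).zdim < Fintype.card ι₁ ^ 2 - 1) :
    hodgeGroupC (prodPeriod Φ₁ Φ₂) = blockDiagProd (hodgeGroupC Φ₁) (hodgeGroupC Φ₂) := by
  haveI : Nonempty ι₁ := Fintype.card_pos_iff.1 (by omega)
  exact hodgeGroupC_prod_eq_blockDiagProd_of_isSimple_lieSubalgebraGL_of_zdim_lt Φ₁ Φ₂
    (isSimple_lieSubalgebraGL_map_toGL_hodgeGroupC_of_eq_top h₁ hι₁) (by rwa [zdim_map_toGL_hodgeGroupC_eq_of_eq_top h₁])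

/-- **A HODGE-GENERAL TORUS TIMES ANY TORUS OF SMALLER DIMENSION: `Hg(X₁ × X₂)(ℂ) = SL(V₁,ℂ) × Hg(X₂)(ℂ)`**
(`dim Hg(X₂) ≤ (2g₂)² − 1 < (2g₁)² − 1 = dim Hg(X₁)`; e.g. the general torus of dimension `≥ 2` times any elliptic
curve, a non-CM elliptic curve times nothing smaller). [cite: Imai1976HodgeGroups, §3 Remarks (p. 370 L44–L54: "by dimension")]
[cite: MoonenZarhin1999LowDim, §3 (3.1)] [cite: Gordon1997, §2.16 Proposition] -/
theorem hodgeGroupC_prod_eq_blockDiagProd_of_eq_top_of_card_lt (h₁ : hodgeGroupC Φ₁ = ⊤)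
    (hcard : Fintype.card ι₂ < Fintype.card ι₁) :
    hodgeGroupC (prodPeriod Φ₁ Φ₂) = blockDiagProd (hodgeGroupC Φ₁) (hodgeGroupC Φ₂) := by
  have hι₁ := one_lt_card_of_card_lt Φ₁ hcard
  refine hodgeGroupC_prod_eq_blockDiagProd_of_eq_top_of_zdim_lt Φ₁ Φ₂ h₁ hι₁
    ((zdim_map_toGL_hodgeGroupC_le Φ₂).trans_lt ?_)
  have h2 : Fintype.card ι₂ ^ 2 < Fintype.card ι₁ ^ 2 := Nat.pow_lt_pow_left hcard two_ne_zero
  have h3 : 2 ^ 2 ≤ Fintype.card ι₁ ^ 2 := Nat.pow_le_pow_left (Nat.succ_le_of_lt hι₁) 2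
  omega

/-- The mirror: any torus times a Hodge-general torus of LARGER dimension. [cite: Imai1976HodgeGroups, §3 Remarks (p. 370)]
[cite: MoonenZarhin1999LowDim, §3 (3.1)] -/
theorem hodgeGroupC_prod_eq_blockDiagProd_of_card_lt_of_eq_top (hcard : Fintype.card ι₁ < Fintype.card ι₂)
    (h₂ : hodgeGroupC Φ₂ = ⊤) :
    hodgeGroupC (prodPeriod Φ₁ Φ₂) = blockDiagProd (hodgeGroupC Φ₁) (hodgeGroupC Φ₂) := by
  have hι₂ := one_lt_card_of_card_lt Φ₂ hcard
  haveI : Nonempty ι₂ := Fintype.card_pos_iff.1 (by omega)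
  refine hodgeGroupC_prod_eq_blockDiagProd_of_isSimple_lieSubalgebraGL_right_of_zdim_lt Φ₁ Φ₂
    (isSimple_lieSubalgebraGL_map_toGL_hodgeGroupC_of_eq_top h₂ hι₂) ?_
  rw [zdim_map_toGL_hodgeGroupC_eq_of_eq_top h₂]
  refine (zdim_map_toGL_hodgeGroupC_le Φ₁).trans_lt ?_
  have h2 : Fintype.card ι₁ ^ 2 < Fintype.card ι₂ ^ 2 := Nat.pow_lt_pow_left hcard two_ne_zero
  have h3 : 2 ^ 2 ≤ Fintype.card ι₂ ^ 2 := Nat.pow_le_pow_left (Nat.succ_le_of_lt hι₂) 2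
  omega

/-- **TWO HODGE-GENERAL TORI OF DIFFERENT DIMENSIONS: `Hg(X₁ × X₂)(ℂ) = SL(V₁,ℂ) × SL(V₂,ℂ)`.**
[cite: Imai1976HodgeGroups, §3 Remarks (p. 370: "by dimension")] [cite: MoonenZarhin1999LowDim, §3 (3.1)]
[cite: Gordon1997, §2.16 Proposition (second bullet)] -/
theorem hodgeGroupC_prod_eq_blockDiagProd_of_eq_top_of_eq_top_of_card_ne (h₁ : hodgeGroupC Φ₁ = ⊤)
    (h₂ : hodgeGroupC Φ₂ = ⊤) (hne : Fintype.card ι₁ ≠ Fintype.card ι₂) :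
    hodgeGroupC (prodPeriod Φ₁ Φ₂) = blockDiagProd (hodgeGroupC Φ₁) (hodgeGroupC Φ₂) := by
  rcases lt_or_gt_of_ne hne with h | h
  · exact hodgeGroupC_prod_eq_blockDiagProd_of_card_lt_of_eq_top Φ₁ Φ₂ h h₂
  · exact hodgeGroupC_prod_eq_blockDiagProd_of_eq_top_of_card_lt Φ₁ Φ₂ h₁ h

/-- Two Hodge-general tori of the same positive dimension: the Hodge group of the product splits, or BOTH kernels
`K₁`, `K₂` are finite (the graph case; for elliptic curves this is the isogenous case of Imai §3, not decided here).
[cite: Imai1976HodgeGroups, §3 Remarks (p. 370 L23–L30)] [cite: Gordon1997, §2.16 Proposition (second bullet)]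
[cite: MoonenZarhin1999LowDim, §3 (3.1)] -/
theorem hodgeGroupC_prod_eq_blockDiagProd_or_finite_of_eq_top_of_eq_top (h₁ : hodgeGroupC Φ₁ = ⊤)
    (h₂ : hodgeGroupC Φ₂ = ⊤) (hι₁ : 1 < Fintype.card ι₁) (hι₂ : 1 < Fintype.card ι₂) :
    hodgeGroupC (prodPeriod Φ₁ Φ₂) = blockDiagProd (hodgeGroupC Φ₁) (hodgeGroupC Φ₂) ∨
      (((hodgeGroupCProdInl Φ₁ Φ₂ : Subgroup (SpecialLinearGroup ι₁ ℂ)) : Set (SpecialLinearGroup ι₁ ℂ)).Finite ∧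
        ((hodgeGroupCProdInr Φ₁ Φ₂ : Subgroup (SpecialLinearGroup ι₂ ℂ)) : Set (SpecialLinearGroup ι₂ ℂ)).Finite) := by
  by_cases hsplit : hodgeGroupC (prodPeriod Φ₁ Φ₂) = blockDiagProd (hodgeGroupC Φ₁) (hodgeGroupC Φ₂)
  · exact Or.inl hsplit
  · exact Or.inr (finite_hodgeGroupCProdInl_and_finite_hodgeGroupCProdInr_of_isSimple_of_isSimple_of_ne Φ₁ Φ₂
      (isSimple_lieSubalgebraGL_map_toGL_hodgeGroupC_of_eq_top h₁ hι₁)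
      (isSimple_lieSubalgebraGL_map_toGL_hodgeGroupC_of_eq_top h₂ hι₂) hsplit)

/-- **`Hg(X₁)(ℂ) = SL(V₁,ℂ)` (`g₁ ≥ 1`) and `Hg(X₂)(ℂ)` solvable ⟹ `Hg(X₁ × X₂)(ℂ) = SL(V₁,ℂ) × Hg(X₂)(ℂ)`**
(Gordon's lemma). [cite: Gordon1997, §2.16 Proposition and §3 Theorem, proof (p0014 L33–L37)]
[cite: MoonenZarhin1999LowDim, §3 Theorem (2)] [cite: Imai1976HodgeGroups, §2 Proposition (p. 370 L11–L16)] -/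
theorem hodgeGroupC_prod_eq_blockDiagProd_of_eq_top_of_isSolvable (h₁ : hodgeGroupC Φ₁ = ⊤) (hι₁ : 1 < Fintype.card ι₁)
    (h₂ : IsSolvable ↥(hodgeGroupC Φ₂)) :
    hodgeGroupC (prodPeriod Φ₁ Φ₂) = blockDiagProd (hodgeGroupC Φ₁) (hodgeGroupC Φ₂) :=
  hodgeGroupC_prod_eq_blockDiagProd_of_isSimple_lieSubalgebraGL_of_isSolvable Φ₁ Φ₂
    (isSimple_lieSubalgebraGL_map_toGL_hodgeGroupC_of_eq_top h₁ hι₁) h₂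

/-- `Hg(X₁)(ℂ) = SL(V₁,ℂ)` (`g₁ ≥ 1`) and `Hg(X₂)(ℂ)` commutative ⟹ the Hodge group of the product splits.
[cite: Gordon1997, §3 Theorem, proof (p0014 L33–L37)] [cite: Imai1976HodgeGroups, §2 Proposition (p. 370 L11–L16)] -/
theorem hodgeGroupC_prod_eq_blockDiagProd_of_eq_top_of_commutator_eq_bot (h₁ : hodgeGroupC Φ₁ = ⊤)
    (hι₁ : 1 < Fintype.card ι₁) (h₂ : ⁅hodgeGroupC Φ₂, hodgeGroupC Φ₂⁆ = ⊥) :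
    hodgeGroupC (prodPeriod Φ₁ Φ₂) = blockDiagProd (hodgeGroupC Φ₁) (hodgeGroupC Φ₂) :=
  hodgeGroupC_prod_eq_blockDiagProd_of_isSimple_lieSubalgebraGL_of_commutator_eq_bot Φ₁ Φ₂
    (isSimple_lieSubalgebraGL_map_toGL_hodgeGroupC_of_eq_top h₁ hι₁) h₂

variable {Φ₂} in
/-- **A HODGE-GENERAL TORUS TIMES A CM ABELIAN VARIETY: `Hg(X₁ × X₂)(ℂ) = SL(V₁,ℂ) × Hg(X₂)(ℂ)`** (Moonen–Zarhin Thm (2)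
∕ Imai's mixed case, any dimensions). [cite: MoonenZarhin1999LowDim, §3 Theorem (2) (p0006 L74–L78)]
[cite: Imai1976HodgeGroups, §2 Proposition (p. 370 L11–L16)] [cite: Gordon1997, §2.12 Proposition] -/
theorem IsAbelianVariety.hodgeGroupC_prod_eq_blockDiagProd_of_eq_top_of_isCMType (h₁ : hodgeGroupC Φ₁ = ⊤)
    (hι₁ : 1 < Fintype.card ι₁) (hX₂ : IsAbelianVariety Φ₂)
    (hCM : ∃ T : Subalgebra ℚ (Matrix ι₂ ι₂ ℚ), T ≤ endAlgRat Φ₂ ∧ IsReduced T ∧ (∀ a ∈ T, ∀ b ∈ T, a * b = b * a) ∧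
      Module.finrank ℚ T = Fintype.card ι₂) :
    hodgeGroupC (prodPeriod Φ₁ Φ₂) = blockDiagProd (hodgeGroupC Φ₁) (hodgeGroupC Φ₂) :=
  ComplexTorus.IsAbelianVariety.hodgeGroupC_prod_eq_blockDiagProd_of_isSimple_lieSubalgebraGL_of_isCMType Φ₁
    (isSimple_lieSubalgebraGL_map_toGL_hodgeGroupC_of_eq_top h₁ hι₁) hX₂ hCM

/-- Real points: `Hg(X₁ × X₂)(ℝ) = Hg(X₁)(ℝ) × Hg(X₂)(ℝ)` for a Hodge-general `X₁` and any `X₂` of smaller dimension.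
[cite: Imai1976HodgeGroups, §3 Remarks (p. 370)] [cite: MoonenZarhin1999LowDim, §3 (3.1)] -/
theorem hodgeGroup_prod_eq_of_eq_top_of_card_lt (h₁ : hodgeGroupC Φ₁ = ⊤) (hcard : Fintype.card ι₂ < Fintype.card ι₁) :
    hodgeGroup (prodPeriod Φ₁ Φ₂) = ((hodgeGroup Φ₁).prod (hodgeGroup Φ₂)).map (blockDiag ι₁ ι₂) :=
  hodgeGroup_prod_eq_of_hodgeGroupC_prod_eq (hodgeGroupC_prod_eq_blockDiagProd_of_eq_top_of_card_lt Φ₁ Φ₂ h₁ hcard)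

/-- Real points under Gordon's lemma with a Hodge-general factor. [cite: Gordon1997, §2.16 Proposition and §3 Theorem, proof]
[cite: MoonenZarhin1999LowDim, §3 Theorem (2)] -/
theorem hodgeGroup_prod_eq_of_eq_top_of_isSolvable (h₁ : hodgeGroupC Φ₁ = ⊤) (hι₁ : 1 < Fintype.card ι₁)
    (h₂ : IsSolvable ↥(hodgeGroupC Φ₂)) :
    hodgeGroup (prodPeriod Φ₁ Φ₂) = ((hodgeGroup Φ₁).prod (hodgeGroup Φ₂)).map (blockDiag ι₁ ι₂) :=
  hodgeGroup_prod_eq_of_hodgeGroupC_prod_eq (hodgeGroupC_prod_eq_blockDiagProd_of_eq_top_of_isSolvable Φ₁ Φ₂ h₁ hι₁ h₂)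

variable {Φ₁ Φ₂} in
/-- **(D)-transfer: a stably nondegenerate Hodge-general `X₁` times a stably nondegenerate `X₂` of smaller dimension is
stably nondegenerate.** [cite: MoonenZarhin1999LowDim, §3 (3.1) and §1 (condition (D))] [cite: Gordon1997, Thm. 7.6.2] -/
theorem forall_divisorClasses_powPeriod_prod_eq_hodgeClasses_of_eq_top_of_card_lt (h₁ : hodgeGroupC Φ₁ = ⊤)
    (hcard : Fintype.card ι₂ < Fintype.card ι₁)
    (hX₁ : ∀ k p, divisorClasses (powPeriod Φ₁ k) p = hodgeClasses (powPeriod Φ₁ k) p)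
    (hX₂ : ∀ k p, divisorClasses (powPeriod Φ₂ k) p = hodgeClasses (powPeriod Φ₂ k) p) :
    ∀ k p, divisorClasses (powPeriod (prodPeriod Φ₁ Φ₂) k) p = hodgeClasses (powPeriod (prodPeriod Φ₁ Φ₂) k) p :=
  forall_divisorClasses_powPeriod_prod_eq_hodgeClasses_of_hodgeGroupC_prod_eq
    (hodgeGroupC_prod_eq_blockDiagProd_of_eq_top_of_card_lt Φ₁ Φ₂ h₁ hcard) hX₁ hX₂

variable {Φ₁ Φ₂} in
/-- (D)-transfer under Gordon's lemma with a Hodge-general factor. [cite: MoonenZarhin1999LowDim, §3 Theorem (2) and §1]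
[cite: Gordon1997, Thm. 7.6.2] -/
theorem forall_divisorClasses_powPeriod_prod_eq_hodgeClasses_of_eq_top_of_isSolvable (h₁ : hodgeGroupC Φ₁ = ⊤)
    (hι₁ : 1 < Fintype.card ι₁) (h₂ : IsSolvable ↥(hodgeGroupC Φ₂))
    (hX₁ : ∀ k p, divisorClasses (powPeriod Φ₁ k) p = hodgeClasses (powPeriod Φ₁ k) p)
    (hX₂ : ∀ k p, divisorClasses (powPeriod Φ₂ k) p = hodgeClasses (powPeriod Φ₂ k) p) :
    ∀ k p, divisorClasses (powPeriod (prodPeriod Φ₁ Φ₂) k) p = hodgeClasses (powPeriod (prodPeriod Φ₁ Φ₂) k) p :=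
  forall_divisorClasses_powPeriod_prod_eq_hodgeClasses_of_hodgeGroupC_prod_eq
    (hodgeGroupC_prod_eq_blockDiagProd_of_eq_top_of_isSolvable Φ₁ Φ₂ h₁ hι₁ h₂) hX₁ hX₂

/-- **A ONE-DIMENSIONAL TORUS WITH `End_ℚ = ℚ` TIMES A CM ABELIAN VARIETY: `Hg(E × X₂)(ℂ) = SL₂(ℂ) × Hg(X₂)(ℂ)`**
(Imai's mixed case, `X₂` of any dimension). [cite: Imai1976HodgeGroups, §2 Proposition (p. 370 L11–L16)]
[cite: MoonenZarhin1999LowDim, §3 Theorem (2)] -/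
theorem IsAbelianVariety.hodgeGroupC_prod_eq_blockDiagProd_of_endAlgRat_eq_bot_of_isCMType (Ψ : (Fin 2 → ℝ) ≃L[ℝ] ℂ)
    (hE : endAlgRat Ψ = ⊥) {Φ₂ : (ι₂ → ℝ) ≃L[ℝ] E₂} (hX₂ : IsAbelianVariety Φ₂)
    (hCM : ∃ T : Subalgebra ℚ (Matrix ι₂ ι₂ ℚ), T ≤ endAlgRat Φ₂ ∧ IsReduced T ∧ (∀ a ∈ T, ∀ b ∈ T, a * b = b * a) ∧
      Module.finrank ℚ T = Fintype.card ι₂) :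
    hodgeGroupC (prodPeriod Ψ Φ₂) = blockDiagProd (hodgeGroupC Ψ) (hodgeGroupC Φ₂) :=
  ComplexTorus.IsAbelianVariety.hodgeGroupC_prod_eq_blockDiagProd_of_eq_top_of_isCMType Ψ
    (hodgeGroupC_eq_top_of_endAlgRat_eq_bot Ψ hE) (by simp) hX₂ hCM

/-- A one-dimensional torus with `End_ℚ = ℚ` times ANY torus with solvable `Hg(X₂)(ℂ)`: the Hodge group splits.
[cite: Imai1976HodgeGroups, §2 Proposition (p. 370 L11–L16)] [cite: Gordon1997, §2.16 Proposition and §3 Theorem, proof] -/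
theorem hodgeGroupC_prod_eq_blockDiagProd_of_endAlgRat_eq_bot_of_isSolvable (Ψ : (Fin 2 → ℝ) ≃L[ℝ] ℂ)
    (hE : endAlgRat Ψ = ⊥) (h₂ : IsSolvable ↥(hodgeGroupC Φ₂)) :
    hodgeGroupC (prodPeriod Ψ Φ₂) = blockDiagProd (hodgeGroupC Ψ) (hodgeGroupC Φ₂) :=
  hodgeGroupC_prod_eq_blockDiagProd_of_eq_top_of_isSolvable Ψ Φ₂ (hodgeGroupC_eq_top_of_endAlgRat_eq_bot Ψ hE)
    (by simp) h₂

end Product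

end ComplexTorus

end Literature.Geometry.Kaehler

end
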